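import Summits.HodgeConjecture.Statement
import Summits.HodgeConjecture.HodgeConjecture.Theorems.WeilTypeLadder
import Summits.HodgeConjecture.HodgeConjecture.Theses.SevenfoldWeilCensus
import Summits.HodgeConjecture.HodgeConjecture.Theorems.TropicalCuspLiftWeilSixfolds
import Literature.AlgebraicGeometry.HodgeTheory.WeilClassesFourfolds
import Literature.AlgebraicGeometry.HodgeTheory.WeilClassesSixfolds
import Literature.AlgebraicGeometry.HodgeTheory.AbelianLowDimensionHodgeConjecture
import Literature.AlgebraicGeometry.HodgeTheory.AbelianLowDimensionWeilReduction
import Literature.AlgebraicGeometry.Motives.AbelianVarietyProjectiveChart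

/-!
# WeilTypeLadder · ON-PATH lemmas and arrows, kernel-checked (b2b cell `hweil`)

For every rung `R` of the conjecture leaf `Theorems/WeilTypeLadder.lean` the ON-PATH LEMMA
`R_of_hodgeConjecture : HodgeConjecture → R` (each rung is a CASE of the summit — TYPE II ladder), the
arrows rung → rung, and the joints with the FLOOR (the Literature named facts, BY NAME:
F1 `Markman2025_weilClasses_algebraic_abelianFourfold`, F2 `Markman2025_weilClasses_algebraic_hyperbolicSixfold`,
F3 `Markman2025_hodgeClasses_algebraic_abelian_dim_le_five`, and the Moonen–Zarhin reduction
`MoonenZarhin1999_hodgeClasses_abelian_dim_le_five_of_weilClassesFourfolds`) and with the shared route item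
R1 = `WeilSixfolds` (stmt-HodgeConjecture-2524; decl of route `SevenfoldWeilCensus`, same body as the retired
`TropicalCuspLift.WeilSixfolds`). Serves stmt-HodgeConjecture-2524 (what it sits between) without closing it.

DAG (solid = proved here or in the named tree file; `HC` = `_root_.HodgeConjecture`):

  HC ⟶ R∞ `WeilClassesImaginaryQuadratic` ⟶ R2 `SplitWeilAbelianVarieties` ⟶ R2₈ `SplitEightfolds`
  R∞ ⟶ R1 `WeilSixfolds` (stmt-2524) ⟶ R1′ `NonsplitSixfolds`;   R1′ ∧ F2 ⟶ R1
  (`Theorems.weilSixfolds_iff_nonHyperbolic_of_markmanSplit`);   R∞ ⟶ F1;   F1 ∧ MZ ⟶ F3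
  (`MoonenZarhin1999_…_of_weilClassesFourfolds`, combination step proved in
  `AbelianLowDimensionWeilReductionProofs`);   HC ⟶ R3 `WeilClassesCMField`;   HC ⟶ F1, F2, F3
  (`…_of_hodgeConjectureFor` in the Literature files).
-/

noncomputable section

-- every declaration of this problem lives in `Summit.HodgeConjecture.HodgeConjecture.…` (summit = sub-problem)
set_option linter.dupNamespace false

open CategoryTheory
open Literature.AlgebraicGeometry Literature.AlgebraicGeometry.Motives
open Literature.AlgebraicGeometry.HodgeTheory
open Literature.AlgebraicTopology.SingularHomology

namespace Summit.HodgeConjecture.HodgeConjecture.WeilTypeLadder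

/-! ### R1 = the shared item `WeilSixfolds` (stmt-HodgeConjecture-2524) -/

/-- The two route decls carrying item stmt-HodgeConjecture-2524 (`SevenfoldWeilCensus.WeilSixfolds`, live;
`TropicalCuspLift.WeilSixfolds`, retired route, same body) are the same proposition. -/
theorem sevenfold_weilSixfolds_iff_tropical :
    Theses.SevenfoldWeilCensus.WeilSixfolds ↔ Theses.TropicalCuspLift.WeilSixfolds :=
  Iff.rfl

/-- **R1 over the Literature Weil plane**: item stmt-2524 reads — for `0 < d`, `A` smooth projective of
dimension `6`, `φ ≫ φ = -(d • 𝟙 A)`, every rational `(3,3)`-class of `weilClassesOf A φ 3 d` is algebraic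
(`Theorems.weilSixfolds_iff`, by `mem_weilClassesOf_iff`). -/
theorem weilSixfolds_iff_weilClassesOf :
    Theses.SevenfoldWeilCensus.WeilSixfolds ↔
      ∀ (d : ℕ), 0 < d → ∀ (A : Motives.AbelianVariety ℂ) (φ : A ⟶ A), A.dim = 2 * 3 →
        Motives.IsSmoothProjective (2 * 3) A.X → φ ≫ φ = -(d • 𝟙 A) →
          ∀ c : complexBetti A.X (2 * 3), IsRationalClass c → IsOfHodgeType (2 * 3) A.X (2 * 3) 3 3 c →
            c ∈ weilClassesOf A φ 3 d → c ∈ algebraicClasses A.X 3 :=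
  sevenfold_weilSixfolds_iff_tropical.trans Theorems.weilSixfolds_iff

/-- ON-PATH (R1): `HodgeConjecture → WeilSixfolds` (= `Theorems.weilSixfolds_of_hodgeConjecture`). -/
theorem weilSixfolds_of_hodgeConjecture (h : _root_.HodgeConjecture) :
    Theses.SevenfoldWeilCensus.WeilSixfolds :=
  sevenfold_weilSixfolds_iff_tropical.2 (Theorems.weilSixfolds_of_hodgeConjecture h)

/-! ### R1′ `NonsplitSixfolds` -/

/-- ON-PATH (R1′): `HodgeConjecture → NonsplitSixfolds` — the rung is the instance of the summit over the
non-split abelian sixfolds, restricted to the Weil plane. -/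
theorem nonsplitSixfolds_of_hodgeConjecture (h : _root_.HodgeConjecture) : NonsplitSixfolds :=
  fun _ _ _ _ _ hX _ _ c hc h33 _ ↦ (h hX).2 3 c hc h33

/-- ARROW R1 ⟶ R1′: the non-split rung is a restriction of the all-sixfolds item. -/
theorem nonsplitSixfolds_of_weilSixfolds (h : Theses.SevenfoldWeilCensus.WeilSixfolds) : NonsplitSixfolds :=
  Theorems.nonHyperbolic_of_weilSixfolds (sevenfold_weilSixfolds_iff_tropical.1 h)

/-- JOINT WITH THE FLOOR, R1′ ∧ F2 ⟶ R1: granted Markman's split-sixfold theorem (named fact F2,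
arXiv:2502.03415 Thm. 1.5.1, UNREFEREED), the non-split rung gives ALL sixfolds — by cases on the existence of
a hyperbolic `K`-symmetrised hyperplane class (`Theorems.weilSixfolds_of_markmanSplit_of_nonHyperbolic`).
CONDITIONAL on [Markman 2025, Thm. 1.5.1]. -/
theorem weilSixfolds_of_nonsplitSixfolds_of_floor
    (hF2 : Markman2025_weilClasses_algebraic_hyperbolicSixfold) (h : NonsplitSixfolds) :
    Theses.SevenfoldWeilCensus.WeilSixfolds :=
  sevenfold_weilSixfolds_iff_tropical.2 (Theorems.weilSixfolds_of_markmanSplit_of_nonHyperbolic hF2 h)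

/-! ### R2₈ `SplitEightfolds`, R2 `SplitWeilAbelianVarieties` -/

/-- ON-PATH (R2₈): `HodgeConjecture → SplitEightfolds`. -/
theorem splitEightfolds_of_hodgeConjecture (h : _root_.HodgeConjecture) : SplitEightfolds :=
  fun _ _ _ _ _ hX _ _ _ _ _ _ c hc h44 _ ↦ (h hX).2 4 c hc h44

/-- ON-PATH (R2): `HodgeConjecture → SplitWeilAbelianVarieties`. -/
theorem splitWeilAbelianVarieties_of_hodgeConjecture (h : _root_.HodgeConjecture) :
    SplitWeilAbelianVarieties :=
  fun n _ _ _ _ _ _ hX _ _ _ _ _ _ c hc hnn _ ↦ (h hX).2 n c hc hnn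

/-- ARROW R2 ⟶ R2₈ (instance `n = 4`). -/
theorem splitEightfolds_of_splitWeilAbelianVarieties (h : SplitWeilAbelianVarieties) : SplitEightfolds :=
  h 4 le_rfl

/-! ### R∞ `WeilClassesImaginaryQuadratic` -/

/-- ON-PATH (R∞): `HodgeConjecture → WeilClassesImaginaryQuadratic`. -/
theorem weilClassesImaginaryQuadratic_of_hodgeConjecture (h : _root_.HodgeConjecture) :
    WeilClassesImaginaryQuadratic :=
  fun n _ _ _ _ _ _ hX _ c hc hnn _ ↦ (h hX).2 n c hc hnn

/-- ARROW R∞ ⟶ R2 (drop the hyperbolicity hypothesis; `4 ≤ n` gives `2 ≤ n`). -/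
theorem splitWeilAbelianVarieties_of_weilClassesImaginaryQuadratic (h : WeilClassesImaginaryQuadratic) :
    SplitWeilAbelianVarieties :=
  fun n hn d hd A φ hA hX hφ _ _ _ _ _ c hc hnn hW ↦
    h n (le_trans (by norm_num) hn) d hd A φ hA hX hφ c hc hnn hW

/-- ARROW R∞ ⟶ R1 (instance `n = 3`, over `weilClassesOf`). -/
theorem weilSixfolds_of_weilClassesImaginaryQuadratic (h : WeilClassesImaginaryQuadratic) :
    Theses.SevenfoldWeilCensus.WeilSixfolds :=
  weilSixfolds_iff_weilClassesOf.2 (h 3 (by norm_num))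

/-- ARROW R∞ ⟶ R1′. -/
theorem nonsplitSixfolds_of_weilClassesImaginaryQuadratic (h : WeilClassesImaginaryQuadratic) :
    NonsplitSixfolds :=
  nonsplitSixfolds_of_weilSixfolds (weilSixfolds_of_weilClassesImaginaryQuadratic h)

/-- ARROW R∞ ⟶ F1 (instance `n = 2` is the statement of Markman's fourfold theorem). -/
theorem floorFourfolds_of_weilClassesImaginaryQuadratic (h : WeilClassesImaginaryQuadratic) :
    Markman2025_weilClasses_algebraic_abelianFourfold :=
  h 2 le_rfl

/-- R∞ gives, over `weilClassesOf`, the target `WeilClassesAlgebraic` (stmt-HodgeConjecture-2522) of the retired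
route `TropicalCuspLift` (`mem_weilClassesOf_iff`, uniformly in `n`). -/
theorem weilClassesAlgebraic_of_weilClassesImaginaryQuadratic (h : WeilClassesImaginaryQuadratic) :
    Theses.TropicalCuspLift.WeilClassesAlgebraic := by
  unfold Theses.TropicalCuspLift.WeilClassesAlgebraic
  exact fun n hn d hd A φ hA hX hφ c hc hnn hW ↦ h n hn d hd A φ hA hX hφ c hc hnn (mem_weilClassesOf_iff.2 hW)

/-- Conversely the retired target `TropicalCuspLift.WeilClassesAlgebraic` (stmt-2522) gives R∞: the two are
the same statement up to `mem_weilClassesOf_iff`. -/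
theorem weilClassesImaginaryQuadratic_of_weilClassesAlgebraic (h : Theses.TropicalCuspLift.WeilClassesAlgebraic) :
    WeilClassesImaginaryQuadratic := by
  unfold Theses.TropicalCuspLift.WeilClassesAlgebraic at h
  exact fun n hn d hd A φ hA hX hφ c hc hnn hW ↦ h n hn d hd A φ hA hX hφ c hc hnn (mem_weilClassesOf_iff.1 hW)

/-! ### R3 `WeilClassesCMField` -/

/-- ON-PATH (R3): `HodgeConjecture → WeilClassesCMField` — every complex abelian variety is smooth projective
of dimension `A.dim` (`Motives.AbelianVariety.isSmoothProjective_holds`), and the rung asks for rational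
`(m,m)`-classes in `H^{2m}` to be algebraic, an instance of `HodgeConjectureFor A.dim A.X`. -/
theorem weilClassesCMField_of_hodgeConjecture (h : _root_.HodgeConjecture) : WeilClassesCMField :=
  fun A _ _ _ m _ _ _ _ _ _ _ _ c _ hc hmm ↦
    (h (show Motives.IsSmoothProjective A.dim A.X from
      Motives.AbelianVariety.isSmoothProjective_holds (A := A))).2 m c hc hmm

/-! ### The floor below the rungs (joints BY NAME; nothing re-vendored)

The on-path lemmas of the floor facts F1, F2 are the Literature theorems
`Markman2025_weilClasses_algebraic_abelianFourfold_of_hodgeConjectureFor`,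
`Markman2025_weilClasses_algebraic_hyperbolicSixfold_of_hodgeConjectureFor` (apply them to `h : HodgeConjecture`
directly: the summit is definitionally their hypothesis). -/

/-- ON-PATH (F3): `HodgeConjecture →` "HC for abelian varieties of dimension `≤ 5`" (its statement; = the
route support item `SevenfoldWeilCensus.HodgeAbelianDimLeFive`, stmt-HodgeConjecture-18723, definitionally). -/
theorem floorDimLeFive_of_hodgeConjecture (h : _root_.HodgeConjecture) :
    Theses.SevenfoldWeilCensus.HodgeAbelianDimLeFive :=
  Markman2025_hodgeClasses_algebraic_abelian_dim_le_five_of_hodgeConjectureFor h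

/-- THE CLASSICAL REDUCTION (Moonen–Zarhin 1999, refereed) AT THE JOINT: R∞ (indeed its instance `n = 2` =
F1) and the named reduction fact give HC in dimension `≤ 5` (item stmt-18723). CONDITIONAL on the named fact
`MoonenZarhin1999_hodgeClasses_abelian_dim_le_five_of_weilClassesFourfolds` (whose combination step is proved
in `AbelianLowDimensionWeilReductionProofs` from (L11), (MZ4), (MZ5)). -/
theorem floorDimLeFive_of_weilClassesImaginaryQuadratic_of_moonenZarhin
    (hMZ : MoonenZarhin1999_hodgeClasses_abelian_dim_le_five_of_weilClassesFourfolds)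
    (h : WeilClassesImaginaryQuadratic) : Theses.SevenfoldWeilCensus.HodgeAbelianDimLeFive :=
  hMZ (floorFourfolds_of_weilClassesImaginaryQuadratic h)

end Summit.HodgeConjecture.HodgeConjecture.WeilTypeLadder

end
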